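import Summits.RiemannHypothesis.RiemannHypothesis.Theses.EvenThetaVisibilityPinning
import Summits.RiemannHypothesis.RiemannHypothesis.Theorems.GroundBartaPolarPerronFrobeniusThetaWindowCollarArch
import HarnessLib

/-!
# Route `EvenThetaVisibilityPinning`, item `ThetaWindowImage` (stmt-RiemannHypothesis-19848) — closed

For `a ≥ 2` the smooth theta window vector `Θ_a = Φ·σ((a−t)e^{2a})σ((a+t)e^{2a})` is a Weil test
whose even window image is represented in `L²` by `T_a = 𝟙_{[-a,a]} · W(τ_· Θ_a)` with
`‖T_a‖₂ ≤ C x^C e^{−π x}`, `x = e^{2a}` — the GroundBarta theta-vector toolkit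
(`PolarPerronFrobenius.thetaWindowImage_statement`, Theorems/GroundBartaPolarPerronFrobeniusThetaWindow*.lean:
translate identity `W(g ⋆ h̃) = ∫ g conj W(τ_u h)`, harmonicity of the translates of Riemann's
kernel, and the collar estimate `‖W(τ_u κ_a)‖ ≤ C x^{9/4+β} e^{−πx}` from the super-exponential tails
of `Φ, Φ′`).  RH-free.  References: Bombieri 2000 Thm 2; de Bruijn (kernel `Φ`).
-/

set_option linter.dupNamespace false

namespace Summit.RiemannHypothesis.RiemannHypothesis.Theorems.EvenThetaVisibilityPinning

/-- **Item `ThetaWindowImage` (stmt-RiemannHypothesis-19848)**. [cite: Bombieri2000Weil, Thm 2] -/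
theorem thetaWindowImage_proof :
    Summit.RiemannHypothesis.RiemannHypothesis.Theses.EvenThetaVisibilityPinning.ThetaWindowImage :=
  Summit.RiemannHypothesis.RiemannHypothesis.Theorems.PolarPerronFrobenius.thetaWindowImage_statement

end Summit.RiemannHypothesis.RiemannHypothesis.Theorems.EvenThetaVisibilityPinning
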